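import Literature.Topology.FourManifolds.CorkDecompositionLeaves
import Literature.Topology.FourManifolds.CorkDecompositionMiddleLevelOfBasisTheorem
import HarnessLib

/-!
# The cork decomposition theorem: split record (two named-fact children)

Topic `Literature/Topology/FourManifolds`. Split record (librarian, fact-decompose) for the named
fact `Literature.Topology.FourManifolds.corkDecomposition` (`CorkTwist.lean`: Curtis–Freedman–
Hsiang–Stong, Invent. Math. 123 (1996); R. Matveyev, *A decomposition of smooth simply-connected
h-cobordant 4-manifolds*, J. Differential Geom. 44 (1996), Theorem 1 — two h-cobordant simply
connected closed smooth 4-manifolds differ by a cork twist along a compact contractible `C`).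

The tree proves `corkDecomposition` along Matveyev's printed proof down to two named facts
(`corkDecomposition_of_middleLevel_leaves`, `CorkDecompositionLeaves.lean`: Milnor's Thm. 8.1 at
the incoming end of the 5-dimensional h-cobordism is discharged), and the first of those, rung
(B), down to Milnor's Basis Theorem 7.6 on a slab
(`exists_dualSpheres_middleLevel_of_two_three_of_basisTheorem`,
`CorkDecompositionMiddleLevelOfBasisTheorem.lean`: Lemma 7.2 on a slab is discharged). The children
of this split are therefore the two EXISTING named facts

1. `Literature.Topology.FourManifolds.Cobordism.Milnor1965_basisTheorem_slab` — Milnor, *Lectures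
   on the h-cobordism theorem* (1965), Thm. 7.6 (Basis Theorem) on a slab of a Morse function
   (handle slides realising an elementary matrix operation on the intersection form of a
   two-index slab);
2. `Literature.Topology.FourManifolds.Matveyev1996_partOne_and_fact_of_dualSpheres` — (H4),
   Matveyev's Theorem 1 part 1 with Fact 1 *from the middle level on* (pp. 1–3; Kirby 1996 §3,
   Addenda (B), (C)): the four-dimensional construction from two algebraically dual framed
   families of 2-spheres in the middle level (Casson finger moves, the contractible pieces
   `W₁, W₂`, `M₁ ∖ W₁ ≅ M₂ ∖ W₂`, and `W₁ ∪ W₂ ≅ S⁴`); its case of no spheres is proved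
   (`CorkDecompositionMiddleLevelProofs.lean`).

Assembly (PROVED): `corkDecomposition_holds_of : (1) → (2) → corkDecomposition`. Neither child
restates the parent: (1) is a statement about Morse functions on cobordisms of any dimension,
(2) starts from a middle-level surgery presentation, not from an h-cobordism. No definition, no new
named fact.

## References

* R. Matveyev, J. Differential Geom. 44 (1996) 571–582; arXiv:dg-ga/9505001: Theorem 1, Proof of
  Theorem (pp. 1–3), Fact 1. [Matveyev1996]
* C. L. Curtis, M. H. Freedman, W. C. Hsiang, R. Stong, Invent. Math. 123 (1996) 343–348.
  [CurtisFreedmanHsiangStong1996]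
* R. Kirby, *Akbulut's corks and h-cobordisms of smooth, simply connected 4-manifolds*, Turkish J.
  Math. 20 (1996) 85–93, §§2–4. [KirbyCorks1996]
* J. Milnor, *Lectures on the h-cobordism theorem* (1965), Lemma 7.2, Thm. 7.6, Thm. 8.1.
  [MilnorHCobordism1965]
-/

noncomputable section

namespace Literature.Topology.FourManifolds

universe u

/-- **Split assembly for the cork decomposition theorem**: `corkDecomposition` follows from
Milnor's Basis Theorem 7.6 on a slab (`Cobordism.Milnor1965_basisTheorem_slab`, which gives rung
(B) by `exists_dualSpheres_middleLevel_of_two_three_of_basisTheorem`) and the four-dimensional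
construction (H4) (`Matveyev1996_partOne_and_fact_of_dualSpheres`), by
`corkDecomposition_of_middleLevel_leaves`.
[cite: Matveyev1996, Theorem 1 and its proof (arXiv pp. 1–3)] [cite: KirbyCorks1996, §§2–4]
[cite: MilnorHCobordism1965, Thm. 7.6 (PDF p. 50), Thm. 8.1] -/
theorem corkDecomposition_holds_of (h76 : Cobordism.Milnor1965_basisTheorem_slab.{u})
    (h4 : Matveyev1996_partOne_and_fact_of_dualSpheres.{u}) : corkDecomposition.{u} :=
  corkDecomposition_of_middleLevel_leaves
    (exists_dualSpheres_middleLevel_of_two_three_of_basisTheorem h76) h4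

/-- The same two children give Matveyev's printed two-piece form `Matveyev1996_decomposition`
(`matveyev1996_decomposition_of_middleLevel_leaves`). [cite: Matveyev1996, Theorem 1] -/
theorem Matveyev1996_decomposition_holds_of (h76 : Cobordism.Milnor1965_basisTheorem_slab.{u})
    (h4 : Matveyev1996_partOne_and_fact_of_dualSpheres.{u}) : Matveyev1996_decomposition.{u} :=
  matveyev1996_decomposition_of_middleLevel_leaves
    (exists_dualSpheres_middleLevel_of_two_three_of_basisTheorem h76) h4

end Literature.Topology.FourManifolds

end
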